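import Summits.QuantumFields.YangMills.Theorems.BalabanLadderUVSeamRecColdWallDirichletRateOfSplit
import Summits.QuantumFields.YangMills.Theorems.BalabanLadderUVSeamRecColdWallSplitElementaryWindow
import HarnessLib

/-!
# Crux `UVSeamRec` (stmt-QuantumFields-20043), registered line «coldwall_pure» after RESHAPE 2: the measure side BY NAME —
# (CW on the femto tail) ∧ (GD) ⇒ (CW) ∧ (DR) ∧ `PureSplitClSU2` ∧ `ResponseMomentsOdd6SU2`

Helper file (`--supports stmt-QuantumFields-20043`) of the LEAD seat `ym-spine-20043-p1` (gen 16): the press-buttons of the reshaped skeleton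
`Cruxes/UVSeamRec/Lines/coldwall_pure.lean` (sha c86db84aa426ab4c) as importable Theorems, composing p636682 (`ColdWall.coldWallSplit_of_femtoTail`: the
registered (CW) sentence from its femto tail `⌈β^{1/9}⌉ ≤ R + 2`, the rest of the window being settled for every exterior by the tilt inequality) with p635304
(`dirichletRateSU2_of_coldWallSplit_of_gaussianDomination`, `responseMomentsOdd6SU2_of_coldWallSplit_of_gaussianDomination`: torus DLR averaging).  So the
sentence of the registered stub `stub_coldWallSplitFemtoTail` and tempered-d1's `GaussianDominationSU2` (= `stub_gaussianDomination`) give, by name,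
`DirichletRateSU2`, `PureSplitClSU2` and the registered (RM) body `ResponseMomentsOdd6SU2`.
HONEST FRAMING: composition only; (CW-tail), (GD) and the floors are OPEN; nothing of E0′, NT or the gap; YM mass gap NOT proved; not Clay.
-/

set_option autoImplicit false

noncomputable section

open Literature.MathematicalPhysics.QuantumLattice
open Summit.QuantumFields.YangMills.Cruxes.OSLegsFromFemtoAndGap.DlrCollarTransfer
open Summit.QuantumFields.YangMills.Cruxes.UVSeamRec.ResponseMomentsDefs (ResponseMomentsOdd6SU2)
open Summit.QuantumFields.YangMills.Cruxes.UVSeamRec.ClassicalResponse.ColdWall (coldWallSplit_of_femtoTail)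

namespace Summit.QuantumFields.YangMills.Cruxes.UVSeamRec.ClassicalResponse

/-- **(CW on the femto tail) ∧ (GD) ⇒ (DR)**: the sentence of the registered stub `stub_coldWallSplitFemtoTail` and `GaussianDominationSU2` give tempered-d1's
`DirichletRateSU2` (elementary window p636682 + torus averaging p635304). [folklore] -/
theorem dirichletRateSU2_of_coldWallSplitFemtoTail_of_gaussianDomination
    (htail : ∃ (C_s C₁ A₂ β₂ ℓ₂ : ℝ), 0 < C_s ∧ 0 < C₁ ∧ 0 ≤ A₂ ∧ 0 < ℓ₂ ∧
      ∀ β : ℝ, β₂ ≤ β → ∀ R : ℕ, 1 ≤ R → ⌈β ^ (1 / 9 : ℝ)⌉₊ ≤ R + 2 → (R : ℝ) * Transport.uRec β ≤ ℓ₂ →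
      ∀ (q : Fin 4 × Fin 4) (x : Fin 4 → ℤ), q.1 < q.2 → ∀ η : LGConfig 4 (Matrix.specialUnitaryGroup (Fin 2) ℂ),
      (R : ℝ) ^ 4 / C₁ * |kerE (Matrix.specialUnitaryGroup (Fin 2) ℂ) (fundamentalLatticeRep 2) β (fun k => x k - (R + 1)) (2 * R + 3) η
          (plane (Matrix.specialUnitaryGroup (Fin 2) ℂ) (fundamentalLatticeRep 2) q x) -
        kerE (Matrix.specialUnitaryGroup (Fin 2) ℂ) (fundamentalLatticeRep 2) β (fun k => x k - (R + 1)) (2 * R + 3) 1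
          (plane (Matrix.specialUnitaryGroup (Fin 2) ℂ) (fundamentalLatticeRep 2) q x)| ≤
        A₂ + carrierCl (fundamentalLatticeRep 2) C_s 1 β R q x η)
    (hGD : GaussianDominationSU2) : DirichletRateSU2 :=
  dirichletRateSU2_of_coldWallSplit_of_gaussianDomination (coldWallSplit_of_femtoTail htail) hGD

/-- **(CW on the femto tail) ∧ (GD) ⇒ the flag-free split `PureSplitClSU2`.** [folklore] -/
theorem pureSplitClSU2_of_coldWallSplitFemtoTail_of_gaussianDomination
    (htail : ∃ (C_s C₁ A₂ β₂ ℓ₂ : ℝ), 0 < C_s ∧ 0 < C₁ ∧ 0 ≤ A₂ ∧ 0 < ℓ₂ ∧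
      ∀ β : ℝ, β₂ ≤ β → ∀ R : ℕ, 1 ≤ R → ⌈β ^ (1 / 9 : ℝ)⌉₊ ≤ R + 2 → (R : ℝ) * Transport.uRec β ≤ ℓ₂ →
      ∀ (q : Fin 4 × Fin 4) (x : Fin 4 → ℤ), q.1 < q.2 → ∀ η : LGConfig 4 (Matrix.specialUnitaryGroup (Fin 2) ℂ),
      (R : ℝ) ^ 4 / C₁ * |kerE (Matrix.specialUnitaryGroup (Fin 2) ℂ) (fundamentalLatticeRep 2) β (fun k => x k - (R + 1)) (2 * R + 3) η
          (plane (Matrix.specialUnitaryGroup (Fin 2) ℂ) (fundamentalLatticeRep 2) q x) -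
        kerE (Matrix.specialUnitaryGroup (Fin 2) ℂ) (fundamentalLatticeRep 2) β (fun k => x k - (R + 1)) (2 * R + 3) 1
          (plane (Matrix.specialUnitaryGroup (Fin 2) ℂ) (fundamentalLatticeRep 2) q x)| ≤
        A₂ + carrierCl (fundamentalLatticeRep 2) C_s 1 β R q x η)
    (hGD : GaussianDominationSU2) : PureSplitClSU2 :=
  pureSplitClSU2_of_coldWallSplit_of_gaussianDomination (coldWallSplit_of_femtoTail htail) hGD

/-- **THE MEASURE SIDE OF «coldwall_pure» BY NAME: (CW on the femto tail) ∧ (GD) ⇒ the registered (RM) body `ResponseMomentsOdd6SU2`** — the two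
infrared binders of the reshaped skeleton suffice for the E0′ ceilings press-button chain. [folklore] -/
theorem responseMomentsOdd6SU2_of_coldWallSplitFemtoTail_of_gaussianDomination
    (htail : ∃ (C_s C₁ A₂ β₂ ℓ₂ : ℝ), 0 < C_s ∧ 0 < C₁ ∧ 0 ≤ A₂ ∧ 0 < ℓ₂ ∧
      ∀ β : ℝ, β₂ ≤ β → ∀ R : ℕ, 1 ≤ R → ⌈β ^ (1 / 9 : ℝ)⌉₊ ≤ R + 2 → (R : ℝ) * Transport.uRec β ≤ ℓ₂ →
      ∀ (q : Fin 4 × Fin 4) (x : Fin 4 → ℤ), q.1 < q.2 → ∀ η : LGConfig 4 (Matrix.specialUnitaryGroup (Fin 2) ℂ),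
      (R : ℝ) ^ 4 / C₁ * |kerE (Matrix.specialUnitaryGroup (Fin 2) ℂ) (fundamentalLatticeRep 2) β (fun k => x k - (R + 1)) (2 * R + 3) η
          (plane (Matrix.specialUnitaryGroup (Fin 2) ℂ) (fundamentalLatticeRep 2) q x) -
        kerE (Matrix.specialUnitaryGroup (Fin 2) ℂ) (fundamentalLatticeRep 2) β (fun k => x k - (R + 1)) (2 * R + 3) 1
          (plane (Matrix.specialUnitaryGroup (Fin 2) ℂ) (fundamentalLatticeRep 2) q x)| ≤
        A₂ + carrierCl (fundamentalLatticeRep 2) C_s 1 β R q x η)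
    (hGD : GaussianDominationSU2) : ResponseMomentsOdd6SU2 :=
  responseMomentsOdd6SU2_of_coldWallSplit_of_gaussianDomination (coldWallSplit_of_femtoTail htail) hGD

end Summit.QuantumFields.YangMills.Cruxes.UVSeamRec.ClassicalResponse

end
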